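import Summits.ResolutionOfSingularities.ResolutionOfSingularities.Theorems.PAlterationPialtSqueeze
import HarnessLib

/-!
# `PalterationThesis` (crux stmt-ResolutionOfSingularities-0552), line `Sketch` rev. c3: over ANY
# field, resolution of normal radicial quotients of regular varieties implies RRLU1

Helper file of the line lead (c3) for the skeleton `Cruxes/PalterationThesis/Lines/Sketch.lean`
(`--supports stmt-ResolutionOfSingularities-0552`; it does not close the item). The any-field
twin of the glue stub `stub_rrLU1_of_picoverOver` (p138074), with the QUOTIENT form of the
Picover-side residue in place of PICover, so that no Frobenius domination — hence no perfectness
of the ground field — is needed.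

**Statement** (`rrLU1_of_quotOver`). Let `K` be ANY field of characteristic `p` over which every
NORMAL integral separated `K`-scheme of finite type `X` that is the target of a finite,
universally injective, dominant morphism `h : W → X` from an integral REGULAR scheme `W` has a
resolution (`Quot_K`, the right-hand side of `PerfectQuotient.picoverOver_iff_quotient`: "normal
radicial quotients of regular varieties are resolvable"). Then RRLU1 over `K`: for `K ⊆ F ⊆ L`
with `L/F` purely inseparable, `B ⊆ L` a finitely generated regular `K`-subalgebra with
`Frac B = L` and `O ⊇ B` a valuation ring of `L`, the valuation ring `O ∩ F` is locally
uniformizable over `K`.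

**Proof.** `T := B ∩ F` is finitely generated, `Frac T = F`, normal, and `Spec B → Spec T` is
finite, universally injective and surjective from the regular integral `Spec B` (the Frobenius
sandwich of item 0555: `fg_comap_toAlgHom`, `isFractionRing_comap_toAlgHom`,
`isIntegrallyClosed_comap_toAlgHom`, `rr_spec_comap_toAlgHom`). So `Spec T` IS a normal radicial
quotient of a regular variety, `Quot_K` resolves it, and `T ⊆ O ∩ F` makes the resolution
uniformize `O ∩ F` (`exists_affineModel_regular_of_hasResolution`).

Consequence (file `PAlterationPalterationThesisPerfectAtoms.lean`): modulo Temkin's theorem and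
two-model patching over `K`, resolution over EVERY field `K` of characteristic `p` is equivalent
to `Quot_K` — the quotient-side twin of PICover reaches the summit over imperfect fields too,
because Temkin's theorem puts the regular variety on TOP of the radicial morphism (no
`RadicialBottom`, no `DescentPerfectToAll`).

Source: M. Temkin, *Inseparable local uniformization*, J. Algebra 373 (2013), Rem. 1.3.5
(ii)–(iii); O. Zariski, Ann. of Math. 41 (1940) (a resolution uniformizes).
-/

set_option linter.dupNamespace false -- mandated namespace of this single-conjunct summit

noncomputable section

open CategoryTheory CategoryTheory.Limits AlgebraicGeometry TopologicalSpace IsLocalRing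
open Literature.AlgebraicGeometry.Resolution
open Summit.ResolutionOfSingularities.ResolutionOfSingularities.Theorems.Pialt.RadiciallyRegular

namespace Summit.ResolutionOfSingularities.ResolutionOfSingularities.Theorems.PalterationThesis.PerfectAtoms

/-- **Over any field, resolution of normal radicial quotients of regular varieties implies
RRLU1.** Let `K` be a field of characteristic `p` such that every normal integral separated
`K`-scheme of finite type receiving a finite, universally injective, dominant morphism from an
integral regular scheme has a resolution (`hQ`). Then for fields `K ⊆ F ⊆ L` with `L/F` purely
inseparable, a finitely generated REGULAR `K`-subalgebra `B ⊆ L` with `Frac B = L` and a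
valuation ring `O ⊇ B` of `L`, the valuation ring `O ∩ F` of `F` is locally uniformizable over
`K`: `T := B ∩ F` is a finitely generated normal affine model of `F` inside `O ∩ F` and
`Spec B → Spec T` is finite, radicial and surjective (Frobenius sandwich), so `hQ` resolves
`Spec T` and the resolution uniformizes `O ∩ F`. No perfectness, no height-one hypothesis and no
finite generation of `F/K` is used. [cite: Temkin2013, Rem. 1.3.5 (ii)–(iii)] -/
theorem rrLU1_of_quotOver (p : ℕ) (hp : p.Prime) (K : Type) [Field K] [CharP K p]
    (hQ : ∀ (X W : Scheme.{0}) [IsIntegral X] [IsIntegral W] (f : X ⟶ Spec (.of K))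
      (h : W ⟶ X) [IsDominant h], IsSeparated f → LocallyOfFiniteType f → QuasiCompact f →
      (∀ x : X, IsIntegrallyClosed (X.presheaf.stalk x)) → Scheme.IsRegular W →
      IsFinite h → UniversallyInjective h → Scheme.HasResolution X) :
    ∀ (F L : Type) [Field F] [Field L] [Algebra K F] [Algebra F L] [Algebra K L]
      [IsScalarTower K F L], (⊤ : IntermediateField K F).FG → IsPurelyInseparable F L →
      (∃ y : L, y ^ p ∈ (algebraMap F L).range ∧ IntermediateField.adjoin F {y} = ⊤) →
      ∀ B : Subalgebra K L, B.FG → IsFractionRing B L → IsRegularRing B →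
      ∀ O : ValuationSubring L, B.toSubring ≤ O.toSubring →
        IsLocallyUniformizable K F (O.comap (algebraMap F L)) := by
  intro F L _ _ _ _ _ _ _hFfg hpi _hy B hBfg hBfr hBreg O hBO
  haveI : Fact p.Prime := ⟨hp⟩
  -- `B` is regular, hence `Spec B` is regular and `B` is normal
  have hBreg' : Scheme.IsRegular (Spec (.of B)) := Scheme.isRegular_Spec (.of B)
  have hBn : IsIntegrallyClosed B := isIntegrallyClosed_of_isRegularRing B
  -- the Frobenius sandwich `T := B ∩ F ⊆ O ∩ F`
  set T : Subalgebra K F := B.comap (IsScalarTower.toAlgHom K F L) with hTdef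
  have hTfg : T.FG := fg_comap_toAlgHom p B hBfg
  have hTfr : IsFractionRing T F := isFractionRing_comap_toAlgHom p B
  have hTn : IsIntegrallyClosed T := isIntegrallyClosed_comap_toAlgHom p B hBn
  obtain ⟨W, h, hW, hreg, hfin, hui, hsurj⟩ := rr_spec_comap_toAlgHom (K := F) p B hBfg hBreg'
  have hTO : T.toSubring ≤ (O.comap (algebraMap F L)).toSubring := by
    intro x hx
    exact hBO (show IsScalarTower.toAlgHom K F L x ∈ B from hx)
  haveI := hTfr
  haveI := hW
  haveI := hfin
  haveI := hui
  haveI := hTn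
  haveI : Algebra.FiniteType K T := T.fg_iff_finiteType.mp hTfg
  -- `Spec T` as an integral, normal `K`-scheme of finite type
  haveI : IsDomain (CommRingCat.of T) := inferInstanceAs (IsDomain T)
  haveI : IsIntegrallyClosed (CommRingCat.of T) := hTn
  let fT : Spec (.of T) ⟶ Spec (.of K) := Spec.map (CommRingCat.ofHom (algebraMap K T))
  haveI : LocallyOfFiniteType fT :=
    (HasRingHomProperty.Spec_iff (P := @LocallyOfFiniteType)).mpr
      (RingHom.finiteType_algebraMap.mpr ‹_›)
  have hTn' : ∀ y : Spec (.of T), IsIntegrallyClosed ((Spec (.of T)).presheaf.stalk y) :=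
    Literature.AlgebraicGeometry.Motives.isIntegrallyClosed_stalk_Spec (.of T)
  haveI : IsDominant h := ⟨hsurj.denseRange⟩
  -- `Spec T` is a normal radicial quotient of the regular `W`: `hQ` resolves it
  have hresT : Scheme.HasResolution (Spec (.of T)) :=
    hQ (Spec (.of T)) W fT h inferInstance inferInstance inferInstance hTn' hreg hfin hui
  -- a resolution of the affine model `T ⊆ O ∩ F` uniformizes `O ∩ F`
  obtain ⟨A', h', hle, hA'fg, hreg'⟩ :=
    exists_affineModel_regular_of_hasResolution (O.comap (algebraMap F L)) T hTO hTfg hTfr hresT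
  exact ⟨A', h', hA'fg, isFractionRing_of_le hle hTfr, hreg'⟩

/-- **Conversely (trivially), resolution over `K` resolves the normal radicial quotients of
regular `K`-varieties** — they are integral separated `K`-schemes of finite type. [folklore] -/
theorem quotOver_of_resOver (K : Type) [Field K]
    (hres : ∀ (X : Scheme.{0}) (f : X ⟶ Spec (.of K)),
      IsSeparated f → LocallyOfFiniteType f → QuasiCompact f → IsReduced X →
      Scheme.HasResolution X) :
    ∀ (X W : Scheme.{0}) [IsIntegral X] [IsIntegral W] (f : X ⟶ Spec (.of K))
      (h : W ⟶ X) [IsDominant h], IsSeparated f → LocallyOfFiniteType f → QuasiCompact f →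
      (∀ x : X, IsIntegrallyClosed (X.presheaf.stalk x)) → Scheme.IsRegular W →
      IsFinite h → UniversallyInjective h → Scheme.HasResolution X :=
  fun X _ _ _ f _ _ hs hl hq _ _ _ _ => hres X f hs hl hq inferInstance

end Summit.ResolutionOfSingularities.ResolutionOfSingularities.Theorems.PalterationThesis.PerfectAtoms

end
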